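import Summits.BirchSwinnertonDyer.BirchSwinnertonDyer.Theorems.CountingDoorF2AtThreeSemistableRootNumber
import Mathlib.NumberTheory.ArithmeticFunction.Moebius
import Literature.NumberTheory.EllipticCurves.KatoTwistedFinitenessQuadraticTwistProofs
import HarnessLib

/-!
# BirchSwinnertonDyer / CountingDoorF2AtThree — crux I2 `RootNumberPlusLowerDensityLargeF2`
# (stmt-BirchSwinnertonDyer-19441), lane «closed-form local root numbers», part 2: a SQUAREFREE
# discriminant forces semistability; the Liouville–Jacobi normal form `w = −μ(|Δ|)·J(−c₄c₆ | |Δ|)`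

Companion of `Theorems/CountingDoorF2AtThreeSemistableRootNumber.lean` (the closed-form root number
`w(W₀ ⊗ ℚ) = −∏_{p ∣ Δ} s_p(W₀)` of an integer equation with no prime dividing both `Δ` and `c₄`,
modulo the Modularity Theorem `exists_isNewformOf` only). Here:

* `forall_not_dvd_c₄_of_squarefree` — if `Δ(W₀)` is squarefree then no prime divides both `Δ` and
  `c₄` (at `p ≥ 5` from `1728Δ = c₄³ − c₆²`; at `3` from `4Δ = −b₂²(b₂b₆ − b₄²) − 32b₄³ − 108b₆² +
  36b₂b₄b₆`, giving `27 ∣ Δ`; at `2` from `Δ ≡ −27b₆² (mod 8)`, giving `4 ∣ Δ` — Kodaira: `v(Δ) = 1`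
  only in type `I₁`), so EVERY squarefree-discriminant integer equation is in the scope of part 1;
* `rootNumber_eq_liouville_mul_jacobiSym_of_odd` / `rootNumber_eq_neg_moebius_mul_jacobiSym` —
  **Liouville–Jacobi normal form**: for `Δ` odd squarefree,
  `w(W₀ ⊗ ℚ) = −(−1)^{ω(|Δ|)}·J(−c₄c₆ | |Δ|) = −μ(|Δ|)·J(−c₄c₆ | |Δ|)`;
  `rootNumber_eq_liouville_mul_jacobiSym_of_even` — for `2 ∥ Δ` squarefree, `m = |Δ|/2`:
  `w = −s₂·(−1)^{ω(m)}·J(−c₄c₆ | m)` with the explicit sign `s₂` at `2`;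
* the arithmetic helper `moebius_eq_neg_one_pow_card_primeFactors` (the Jacobi product over the
  prime factors is the tree's `prod_primeFactors_jacobiSym`);
* §3 `legendreSym_c₄_eq_one`, `jacobiSym_c₄_natAbs_Δ` (`J(c₄ | |Δ|) = 1`: at a multiplicative prime
  `c₄ ≡ (c₆/c₄)²`), `jacobiSym_neg_c₄_mul_c₆_natAbs_Δ` (`J(−c₄c₆ | |Δ|) = J(−c₆ | |Δ|)`) and
  `rootNumber_eq_neg_moebius_mul_jacobiSym_neg_c₆`: `w = −μ(|Δ|)·J(−c₆ | |Δ|)`, Rohrlich's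
  `w_p = −(−c₆ | p)` globalised.

So on the squarefree-discriminant locus of ANY integral family the root number is
(a `2`-adic sign) × (the Liouville/Möbius function of the discriminant) × (a Jacobi symbol): Helfgott's
`W = (pliable) · λ(M_E)` made explicit and kernel-checked; the parity obstruction behind crux I2 is the
factor `μ(|Δ|)`. Nothing is asserted beyond the displayed hypothesis `exists_isNewformOf`.
PARTITION: none — r_an ≥ 2, summit axis S0; TWIN (D-0056): n/a. B1 honesty: root-number bookkeeping for
explicit equations; nothing reads r_an; no S0 motion.

References: D. Rohrlich, *Compositio Math.* 87 (1993) Prop. 2 [Rohrlich1993Compositio]; L. Cowland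
Kellock, V. Dokchitser, *Bull. LMS* 55 (2023) Cor. 2.5 [KellockDokchitser2023]; J. H. Silverman, *AEC*
2nd ed. (2009) VII.5 Prop. 5.1, Table 15.1 [SilvermanAEC2009]; H. A. Helfgott, arXiv:math/0408141 §1
[Helfgott2004RootNumber].
-/

set_option linter.dupNamespace false
set_option autoImplicit false

noncomputable section

open scoped Classical NumberTheorySymbols

open IsDedekindDomain Rat.HeightOneSpectrum WeierstrassCurve
  Summit.BirchSwinnertonDyer.BirchSwinnertonDyer.Rank2Observatory.RootNumber

namespace Summit.BirchSwinnertonDyer.BirchSwinnertonDyer.Theorems.SemistableRootNumber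

variable {W₀ : WeierstrassCurve ℤ}

/-! ### §1 A squarefree discriminant forces semistability -/


/-- **A squarefree discriminant forces semistability**: if `Δ(W₀)` is squarefree then no prime divides
both `Δ(W₀)` and `c₄(W₀)`. At `p ≥ 5`: `p ∣ c₄, Δ` gives `p ∣ c₆` (`c₆² = c₄³ − 1728Δ`) and then
`p² ∣ c₄³ − c₆² = 1728Δ`, `p² ∣ Δ`; at `p = 3`: `3 ∣ c₄` is `3 ∣ b₂`, and with
`4Δ = −b₂²(b₂b₆ − b₄²) − 32b₄³ − 108b₆² + 36b₂b₄b₆` one gets `3 ∣ b₄` and `27 ∣ Δ`; at `p = 2`: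
`2 ∣ c₄` is `2 ∣ a₁`, then `Δ ≡ −27b₆² (mod 8)` and `2 ∣ Δ` forces `4 ∣ Δ` (Kodaira: `v(Δ) = 1`
only for type `I₁`). [cite: SilvermanAEC2009, VII.5 Prop. 5.1 and Table 15.1] -/
theorem forall_not_dvd_c₄_of_squarefree (hsq : Squarefree W₀.Δ) :
    ∀ p : ℕ, p.Prime → (p : ℤ) ∣ W₀.Δ → ¬ (p : ℤ) ∣ W₀.c₄ := by
  intro p hp hΔ hc₄
  have hp' : Prime (p : ℤ) := Nat.prime_iff_prime_int.mp hp
  have hnu : ¬ IsUnit (p : ℤ) := hp'.not_unit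
  -- it suffices to show `p² ∣ Δ`
  suffices h2 : (p : ℤ) * p ∣ W₀.Δ from hnu (hsq _ h2)
  have hb : 4 * W₀.b₈ = W₀.b₂ * W₀.b₆ - W₀.b₄ ^ 2 := W₀.b_relation
  have hΔdef : W₀.Δ = -W₀.b₂ ^ 2 * W₀.b₈ - 8 * W₀.b₄ ^ 3 - 27 * W₀.b₆ ^ 2
      + 9 * W₀.b₂ * W₀.b₄ * W₀.b₆ := rfl
  by_cases hp2 : p = 2
  · subst hp2
    have ha₁ : (2 : ℤ) ∣ W₀.a₁ := (two_dvd_c₄_iff W₀).mp (by exact_mod_cast hc₄)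
    obtain ⟨k, hk⟩ := ha₁
    have hb₂ : W₀.b₂ = 4 * (k ^ 2 + W₀.a₂) := by
      simp only [WeierstrassCurve.b₂, hk]; ring
    have hb₄ : W₀.b₄ = 2 * (W₀.a₄ + k * W₀.a₃) := by
      simp only [WeierstrassCurve.b₄, hk]; ring
    -- `Δ + 27 b₆² ∈ 8ℤ`
    have h8 : W₀.Δ = 8 * (-2 * (k ^ 2 + W₀.a₂) ^ 2 * W₀.b₈ - 8 * (W₀.a₄ + k * W₀.a₃) ^ 3
        + 9 * (k ^ 2 + W₀.a₂) * (W₀.a₄ + k * W₀.a₃) * W₀.b₆) - 27 * W₀.b₆ ^ 2 := by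
      rw [hΔdef, hb₂, hb₄]; ring
    have hΔ2 : (2 : ℤ) ∣ W₀.Δ := by exact_mod_cast hΔ
    have hb₆ : (2 : ℤ) ∣ W₀.b₆ := by
      have : (2 : ℤ) ∣ 27 * W₀.b₆ ^ 2 := by
        have h' : 27 * W₀.b₆ ^ 2 = 8 * (-2 * (k ^ 2 + W₀.a₂) ^ 2 * W₀.b₈
            - 8 * (W₀.a₄ + k * W₀.a₃) ^ 3
            + 9 * (k ^ 2 + W₀.a₂) * (W₀.a₄ + k * W₀.a₃) * W₀.b₆) - W₀.Δ := by linarith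
        rw [h']
        exact dvd_sub (dvd_mul_of_dvd_left (by norm_num) _) hΔ2
      have h27 : (2 : ℤ) ∣ W₀.b₆ ^ 2 :=
        (Int.prime_two.dvd_or_dvd this).resolve_left (by norm_num)
      exact Int.prime_two.dvd_of_dvd_pow h27
    obtain ⟨m, hm⟩ := hb₆
    refine ⟨2 * (-2 * (k ^ 2 + W₀.a₂) ^ 2 * W₀.b₈ - 8 * (W₀.a₄ + k * W₀.a₃) ^ 3
        + 9 * (k ^ 2 + W₀.a₂) * (W₀.a₄ + k * W₀.a₃) * W₀.b₆) - 27 * m ^ 2, ?_⟩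
    rw [h8, hm]; push_cast; ring
  by_cases hp3 : p = 3
  · subst hp3
    -- `3 ∣ c₄ = b₂² − 24 b₄` gives `3 ∣ b₂`
    have hb₂ : (3 : ℤ) ∣ W₀.b₂ := by
      have h' : (3 : ℤ) ∣ W₀.b₂ ^ 2 := by
        have : W₀.b₂ ^ 2 = W₀.c₄ + 3 * (8 * W₀.b₄) := by
          simp only [WeierstrassCurve.c₄]; ring
        rw [this]
        exact dvd_add (by exact_mod_cast hc₄) (dvd_mul_right 3 _)
      exact Int.prime_three.dvd_of_dvd_pow h'
    obtain ⟨m, hm⟩ := hb₂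
    have h4Δ : 4 * W₀.Δ = -(3 * m) ^ 2 * (3 * m * W₀.b₆ - W₀.b₄ ^ 2) - 32 * W₀.b₄ ^ 3
        - 108 * W₀.b₆ ^ 2 + 36 * (3 * m) * W₀.b₄ * W₀.b₆ := by
      rw [hΔdef, ← hm]; linear_combination -(W₀.b₂ ^ 2) * hb
    have hΔ3 : (3 : ℤ) ∣ W₀.Δ := by exact_mod_cast hΔ
    have hb₄ : (3 : ℤ) ∣ W₀.b₄ := by
      have : (3 : ℤ) ∣ 32 * W₀.b₄ ^ 3 := by
        have h' : 32 * W₀.b₄ ^ 3 = 3 * (3 * m ^ 2 * W₀.b₄ ^ 2 - 9 * m ^ 3 * W₀.b₆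
            - 36 * W₀.b₆ ^ 2 + 36 * m * W₀.b₄ * W₀.b₆) - 4 * W₀.Δ := by linarith
        rw [h']
        exact dvd_sub (dvd_mul_right 3 _) (dvd_mul_of_dvd_right hΔ3 4)
      have h'' : (3 : ℤ) ∣ W₀.b₄ ^ 3 :=
        (Int.prime_three.dvd_or_dvd this).resolve_left (by norm_num)
      exact Int.prime_three.dvd_of_dvd_pow h''
    obtain ⟨n, hn⟩ := hb₄
    have h27 : 4 * W₀.Δ = 27 * (-m ^ 3 * W₀.b₆ + 3 * m ^ 2 * n ^ 2 - 32 * n ^ 3 - 4 * W₀.b₆ ^ 2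
        + 12 * m * n * W₀.b₆) := by
      rw [h4Δ, hn]; ring
    have hdvd : (27 : ℤ) ∣ 4 * W₀.Δ := ⟨_, h27⟩
    have hcop : IsCoprime (27 : ℤ) 4 := by norm_num [Int.isCoprime_iff_gcd_eq_one]
    have h27' : (27 : ℤ) ∣ W₀.Δ := hcop.dvd_of_dvd_mul_left hdvd
    push_cast
    exact dvd_trans (by norm_num) h27'
  · -- `p ≥ 5`: `p ∣ c₆`, `p² ∣ c₄³ − c₆² = 1728 Δ`, `p ∤ 1728`
    have hc₆ : (p : ℤ) ∣ W₀.c₆ := by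
      have : (p : ℤ) ∣ W₀.c₆ ^ 2 := by
        have h' : W₀.c₆ ^ 2 = W₀.c₄ ^ 3 - 1728 * W₀.Δ := by
          have := W₀.c_relation; linear_combination this
        rw [h']
        exact dvd_sub (dvd_pow hc₄ three_ne_zero) (dvd_mul_of_dvd_right hΔ _)
      exact hp'.dvd_of_dvd_pow this
    have hsq' : (p : ℤ) * p ∣ 1728 * W₀.Δ := by
      rw [W₀.c_relation]
      exact dvd_sub (dvd_trans ⟨p, by ring⟩ (pow_dvd_pow_of_dvd hc₄ 3))
        (dvd_trans ⟨1, by ring⟩ (pow_dvd_pow_of_dvd hc₆ 2))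
    have hcop : IsCoprime ((p : ℤ) * p) 1728 := by
      have h1728 : (1728 : ℤ) = 2 ^ 6 * 3 ^ 3 := by norm_num
      rw [h1728]
      refine IsCoprime.mul_left ?_ ?_ <;>
        refine IsCoprime.mul_right (IsCoprime.pow_right ?_) (IsCoprime.pow_right ?_)
      all_goals
        exact_mod_cast Nat.isCoprime_iff_coprime.mpr ((Nat.coprime_primes hp (by norm_num)).mpr (by omega))
    exact hcop.dvd_of_dvd_mul_left hsq'

/-! ### §6 The Liouville–Jacobi normal form for a squarefree discriminant -/

/-- For a squarefree `n`: `μ(n) = (−1)^{ω(n)} = (−1)^{#n.primeFactors}`. [folklore] -/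
theorem moebius_eq_neg_one_pow_card_primeFactors {n : ℕ} (hn : Squarefree n) :
    ArithmeticFunction.moebius n = (-1) ^ n.primeFactors.card := by
  rw [ArithmeticFunction.moebius_apply_of_squarefree hn, ArithmeticFunction.cardFactors_apply,
    ← List.toFinset_card_of_nodup (Nat.squarefree_iff_nodup_primeFactorsList hn.ne_zero |>.mp hn)]
  rfl

/-- **Liouville–Jacobi normal form, odd squarefree discriminant** (modulo Modularity): if `Δ(W₀)` is
odd and squarefree then `w(W₀ ⊗ ℚ) = −(−1)^{ω(|Δ|)} · J(−c₄c₆ | |Δ|)` — the Liouville function of the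
discriminant times a Jacobi symbol (Helfgott's decomposition `W = (pliable) · λ(M_E)` made explicit
for semistable integer equations). [cite: Rohrlich1993Compositio, Prop. 2(ii)]
[cite: Helfgott2004RootNumber, §1] [cite: KellockDokchitser2023, Cor. 2.5] -/
theorem rootNumber_eq_liouville_mul_jacobiSym_of_odd (hsq : Squarefree W₀.Δ)
    (hodd : ¬ (2 : ℤ) ∣ W₀.Δ)
    (hmod : Literature.NumberTheory.EllipticCurves.ModularForms.exists_isNewformOf) :
    (W₀.baseChange ℚ).rootNumber =
      -((-1) ^ W₀.Δ.natAbs.primeFactors.card * J(-(W₀.c₄ * W₀.c₆) | W₀.Δ.natAbs)) := by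
  have hΔ0 : W₀.Δ ≠ 0 := hsq.ne_zero
  rw [rootNumber_eq_neg_prod_primeFactors hΔ0 (forall_not_dvd_c₄_of_squarefree hsq) hmod]
  congr 1
  have h2 : ∀ p ∈ W₀.Δ.natAbs.primeFactors, p ≠ 2 := by
    intro p hp h
    subst h
    exact hodd (Int.natCast_dvd.mpr (Nat.dvd_of_mem_primeFactors hp))
  rw [Finset.prod_congr rfl fun p hp ↦ if_neg (h2 p hp), Finset.prod_neg,
    Literature.NumberTheory.EllipticCurves.prod_primeFactors_jacobiSym (Int.squarefree_natAbs.mpr hsq)]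

/-- **`w(W₀ ⊗ ℚ) = −μ(|Δ|) · J(−c₄c₆ | |Δ|)`** for an odd squarefree discriminant (modulo Modularity).
[cite: Helfgott2004RootNumber, §1] [cite: Rohrlich1993Compositio, Prop. 2(ii)] -/
theorem rootNumber_eq_neg_moebius_mul_jacobiSym (hsq : Squarefree W₀.Δ) (hodd : ¬ (2 : ℤ) ∣ W₀.Δ)
    (hmod : Literature.NumberTheory.EllipticCurves.ModularForms.exists_isNewformOf) :
    (W₀.baseChange ℚ).rootNumber =
      -(ArithmeticFunction.moebius W₀.Δ.natAbs * J(-(W₀.c₄ * W₀.c₆) | W₀.Δ.natAbs)) := by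
  rw [rootNumber_eq_liouville_mul_jacobiSym_of_odd hsq hodd hmod,
    moebius_eq_neg_one_pow_card_primeFactors (Int.squarefree_natAbs.mpr hsq)]

/-- **Liouville–Jacobi normal form, even squarefree discriminant** (`2 ∥ Δ`, modulo Modularity): with
`m = |Δ|/2` (odd squarefree), `w(W₀ ⊗ ℚ) = −s₂ · (−1)^{ω(m)} · J(−c₄c₆ | m)`, `s₂ = −1` iff
`2 ∣ 54b₆ − 3b₂b₄ + a₂c₄`. [cite: Rohrlich1993Compositio, Prop. 2(ii)]
[cite: Helfgott2004RootNumber, §1] -/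
theorem rootNumber_eq_liouville_mul_jacobiSym_of_even (hsq : Squarefree W₀.Δ)
    (heven : (2 : ℤ) ∣ W₀.Δ)
    (hmod : Literature.NumberTheory.EllipticCurves.ModularForms.exists_isNewformOf) :
    (W₀.baseChange ℚ).rootNumber =
      -((if (2 : ℤ) ∣ 54 * W₀.b₆ - 3 * W₀.b₂ * W₀.b₄ + W₀.a₂ * W₀.c₄ then -1 else 1) *
        ((-1) ^ (W₀.Δ.natAbs / 2).primeFactors.card * J(-(W₀.c₄ * W₀.c₆) | W₀.Δ.natAbs / 2))) := by
  have hΔ0 : W₀.Δ ≠ 0 := hsq.ne_zero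
  have hsqn : Squarefree W₀.Δ.natAbs := Int.squarefree_natAbs.mpr hsq
  obtain ⟨m, hm⟩ : 2 ∣ W₀.Δ.natAbs := Int.natCast_dvd.mp heven
  have hm0 : m ≠ 0 := by rintro rfl; exact hΔ0 (Int.natAbs_eq_zero.mp (by simpa using hm))
  have hmodd : ¬ 2 ∣ m := by
    rintro ⟨k, rfl⟩
    have : (2 * 2) ∣ W₀.Δ.natAbs := ⟨k, by rw [hm]; ring⟩
    exact absurd (hsqn 2 this) (by decide)
  have hdiv : W₀.Δ.natAbs / 2 = m := by rw [hm]; simp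
  have hpf : W₀.Δ.natAbs.primeFactors = insert 2 m.primeFactors := by
    rw [hm, Nat.primeFactors_mul two_ne_zero hm0, Nat.Prime.primeFactors Nat.prime_two]
    rfl
  have h2m : (2 : ℕ) ∉ m.primeFactors := fun h ↦ hmodd (Nat.dvd_of_mem_primeFactors h)
  have hne2 : ∀ p ∈ m.primeFactors, p ≠ 2 := fun p hp h ↦ h2m (h ▸ hp)
  have hsqm : Squarefree m := fun x hx ↦ hsqn x (dvd_trans hx ⟨2, by rw [hm]; ring⟩)
  rw [rootNumber_eq_neg_prod_primeFactors hΔ0 (forall_not_dvd_c₄_of_squarefree hsq) hmod, hdiv, hpf,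
    Finset.prod_insert h2m, if_pos rfl]
  congr 2
  rw [Finset.prod_congr rfl fun p hp ↦ if_neg (hne2 p hp), Finset.prod_neg,
    Literature.NumberTheory.EllipticCurves.prod_primeFactors_jacobiSym hsqm]

/-! ### §3 `J(c₄ | |Δ|) = 1`: the Jacobi factor is `J(−c₆ | |Δ|)` (Rohrlich's `−(−c₆ | p)` verbatim) -/

/-- A Jacobi symbol all of whose Legendre factors are `1` is `1`. [folklore] -/
theorem jacobiSym_eq_one_of_forall_legendreSym_eq_one {a : ℤ} {b : ℕ} (hb : b ≠ 0)
    (h : ∀ (p : ℕ) (hp : p.Prime), p ∣ b → @legendreSym p ⟨hp⟩ a = 1) : J(a | b) = 1 := by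
  induction b using induction_on_primes with
  | zero => exact absurd rfl hb
  | one => exact jacobiSym.one_right a
  | prime_mul p m hp ih =>
    have hp0 : p ≠ 0 := hp.ne_zero
    have hm0 : m ≠ 0 := fun h0 ↦ hb (by rw [h0, mul_zero])
    haveI : Fact p.Prime := ⟨hp⟩
    rw [jacobiSym.mul_right' a hp0 hm0, ← jacobiSym.legendreSym.to_jacobiSym, h p hp (dvd_mul_right p m),
      one_mul]
    exact ih hm0 fun q hq hqm ↦ h q hq (dvd_mul_of_dvd_right hqm p)

/-- **At a multiplicative prime `c₄` is a nonzero square**: if `p ∣ Δ(W₀)` and `p ∤ c₄(W₀)` then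
`(c₄ | p) = 1`, because `c₄³ ≡ c₆² (mod p)` (`1728Δ = c₄³ − c₆²`) gives `c₄ ≡ (c₆/c₄)²`.
[cite: SilvermanAEC2009, III.1 (c-relation)] [cite: Rohrlich1993Compositio, Prop. 2(ii)] -/
theorem legendreSym_c₄_eq_one {p : ℕ} [hp : Fact p.Prime] (hΔ : (p : ℤ) ∣ W₀.Δ)
    (hc₄ : ¬ (p : ℤ) ∣ W₀.c₄) : legendreSym p W₀.c₄ = 1 := by
  have hc₄0 : ((W₀.c₄ : ℤ) : ZMod p) ≠ 0 := by
    rwa [Ne, ZMod.intCast_zmod_eq_zero_iff_dvd]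
  refine (legendreSym.eq_one_iff p hc₄0).mpr ⟨(W₀.c₆ : ZMod p) * ((W₀.c₄ : ℤ) : ZMod p)⁻¹, ?_⟩
  have hrel : ((W₀.c₄ : ℤ) : ZMod p) ^ 3 = ((W₀.c₆ : ℤ) : ZMod p) ^ 2 := by
    have h0 : ((1728 * W₀.Δ : ℤ) : ZMod p) = 0 :=
      (ZMod.intCast_zmod_eq_zero_iff_dvd _ p).mpr (dvd_mul_of_dvd_right hΔ _)
    have h1 := congrArg (fun x : ℤ ↦ (x : ZMod p)) W₀.c_relation
    push_cast at h0 h1 ⊢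
    linear_combination -h1 + h0
  field_simp
  linear_combination hrel

/-- **`J(c₄ | |Δ|) = 1` for a semistable integer equation** (no prime divides both `Δ` and `c₄`): every
Legendre factor is `(c₄ | p) = 1`. [cite: Rohrlich1993Compositio, Prop. 2(ii)] -/
theorem jacobiSym_c₄_natAbs_Δ (hΔ0 : W₀.Δ ≠ 0)
    (hss : ∀ p : ℕ, p.Prime → (p : ℤ) ∣ W₀.Δ → ¬ (p : ℤ) ∣ W₀.c₄) :
    J(W₀.c₄ | W₀.Δ.natAbs) = 1 := by
  refine jacobiSym_eq_one_of_forall_legendreSym_eq_one (Int.natAbs_ne_zero.mpr hΔ0) fun p hp hpd ↦ ?_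
  haveI : Fact p.Prime := ⟨hp⟩
  have hΔ : (p : ℤ) ∣ W₀.Δ := Int.natCast_dvd.mpr hpd
  exact legendreSym_c₄_eq_one hΔ (hss p hp hΔ)

/-- **The Jacobi factor of the closed form is Rohrlich's `(−c₆ | ·)`**: for a semistable integer equation,
`J(−c₄c₆ | |Δ|) = J(−c₆ | |Δ|)`. [cite: Rohrlich1993Compositio, Prop. 2(ii)] -/
theorem jacobiSym_neg_c₄_mul_c₆_natAbs_Δ (hΔ0 : W₀.Δ ≠ 0)
    (hss : ∀ p : ℕ, p.Prime → (p : ℤ) ∣ W₀.Δ → ¬ (p : ℤ) ∣ W₀.c₄) :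
    J(-(W₀.c₄ * W₀.c₆) | W₀.Δ.natAbs) = J(-W₀.c₆ | W₀.Δ.natAbs) := by
  rw [show -(W₀.c₄ * W₀.c₆) = W₀.c₄ * -W₀.c₆ by ring, jacobiSym.mul_left,
    jacobiSym_c₄_natAbs_Δ hΔ0 hss, one_mul]

/-- **Liouville–Jacobi normal form with Rohrlich's symbol** (odd squarefree `Δ`, modulo Modularity):
`w(W₀ ⊗ ℚ) = −μ(|Δ|) · J(−c₆ | |Δ|)` — the global form of `w_p = −(−c₆ | p)` at the multiplicative
primes. [cite: Rohrlich1993Compositio, Prop. 2(ii)] [cite: Helfgott2004RootNumber, §1] -/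
theorem rootNumber_eq_neg_moebius_mul_jacobiSym_neg_c₆ (hsq : Squarefree W₀.Δ) (hodd : ¬ (2 : ℤ) ∣ W₀.Δ)
    (hmod : Literature.NumberTheory.EllipticCurves.ModularForms.exists_isNewformOf) :
    (W₀.baseChange ℚ).rootNumber =
      -(ArithmeticFunction.moebius W₀.Δ.natAbs * J(-W₀.c₆ | W₀.Δ.natAbs)) := by
  rw [rootNumber_eq_neg_moebius_mul_jacobiSym hsq hodd hmod,
    jacobiSym_neg_c₄_mul_c₆_natAbs_Δ hsq.ne_zero (forall_not_dvd_c₄_of_squarefree hsq)]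

end Summit.BirchSwinnertonDyer.BirchSwinnertonDyer.Theorems.SemistableRootNumber

end
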